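import Summits.CriticalPhenomena.PercolationContinuityZ3.Theorems.PercNearOneGluingNoHeavyLowerTailSahiSymCubeCheck

/-!
# Sahi's `C_6` on the cube `{0,1}^5` by the symmetry-reduced coloured-antichain check: COMPUTATIONAL chunk A

Support file (cell `prim-sahi`, seat `prim-sahi-typer` gen 29; `--supports stmt-CriticalPhenomena-4575`, computational).  One `native_decide`
evaluation of a range of …`SahiSymCubeCheck`'s `symCheck 5 6 41` (canonical antichains `0, …, 30` of `canonE 5`; 253 order-`6` digit tests
`NCopyCert.checkFamW`, base `2^41`).  Assembled in …`SahiSymCubeFiveSix`. [this work]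
-/

namespace Summit.CriticalPhenomena.PercolationContinuityZ3.Theorems.SahiSymCube

/-- Chunk A of the order-`6` check on `{0,1}^5`: canonical antichains `0, …, 30` (253 digit tests). [this work, computational] -/
theorem symCheck_five_6_chunkA : symCheckRange 5 6 (testN 5 6 41) 0 31 = true := by
  native_decide

end Summit.CriticalPhenomena.PercolationContinuityZ3.Theorems.SahiSymCube
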